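import Summits.ABC.ABC.Theorems.PadicPrimesKummerThirdClosers
import Summits.ABC.ABC.Theorems.PadicPrimesKummerThirdKummerDoor
import Summits.ABC.StewartYu.Y07OfYu2007LogB
import Literature.NumberTheory.DiophantineGeometry.Yu2007PadicLogFormsConsequences
import HarnessLib

/-!
# Stewart–Yu 2001 (exponent 1/3) from the typed PRIMES-ONLY `log B` consequence of Yu 2007, by name
# (cell `abc-stewartyu`; cross-ladder literature-typing seat `lit-abc-yu2007`)

By-name composition, now that both ends are in the tree:

* `Literature.NumberTheory.DiophantineGeometry.Dioph.yu2007_padicLogForm_logB_rat` — the named fact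
  "Yu 2007, consequence of the Main Theorem (p. 190), `log B` form, `K = ℚ`" (p455041), and its
  primes-only corollary `Dioph.yu2007_padicLogForm_logB_primes` (proved there);
* `Summit.ABC.StewartYu.Y07LogB.y07Odd_of_logBPrimes` / `y07Two_of_logBPrimes` (p456345) — the
  route texts `Y07Odd` / `Y07Two` of `PadicPrimesKummerThird` from that primes-only text;
* the route's PROVED door and assembly (`padicPrimesKummerThird_kummerDoor_proof`,
  `padicPrimesKummerThird_assembly_proof`, p3/p4).

Hence `stewart_yu_of_yu2007_logB : yu2007_padicLogForm_logB_rat → stewart_yu`: abc.S06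
(Stewart–Yu 2001 Thm. 1, `log c ≪ rad^{1/3}(log rad)³`) follows from the `log B` form of Yu's
theorem for RATIONAL PRIMES alone (archimedean side: Waldschmidt 1980, proved in the tree) — a
trust path independent of the δ-form fact of record `Literature.Barriers.ABC.yu2007_padicLogForm_rat`
(Evertse–Győry Thm. 3.2.7) used by `stewart_yu_holds_of_yu2007`.  CONDITIONAL on the named fact
(Yu 2007 is cite-only, `acq-02484`); nothing is closed; the route's content is proving `Y07Odd` /
`Y07Two` without any Yu fact. [folklore]
-/

namespace Summit.ABC.StewartYu

namespace Y07LogB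

open Literature.NumberTheory.DiophantineGeometry
open Literature.NumberTheory.DiophantineGeometry.Dioph
open Summit.ABC.ABC.Theses.PadicPrimesKummerThird
open Summit.ABC.ABC.Theorems

/-- `Y07Odd` (item stmt-ABC-19658) from the named fact `yu2007_padicLogForm_logB_rat`, by name.
CONDITIONAL — nothing is closed. [cite: Yu2007, consequence of the Main Theorem, p. 190 (log B form)] -/
theorem y07Odd_of_yu2007_logB (h : yu2007_padicLogForm_logB_rat) : Y07Odd :=
  y07Odd_of_logBPrimes (yu2007_padicLogForm_logB_primes h)

/-- `Y07Two` (item stmt-ABC-19659) from the named fact `yu2007_padicLogForm_logB_rat`, by name.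
CONDITIONAL — nothing is closed. [cite: Yu2007, consequence of the Main Theorem, p. 190 (log B form)] -/
theorem y07Two_of_yu2007_logB (h : yu2007_padicLogForm_logB_rat) : Y07Two :=
  y07Two_of_logBPrimes (yu2007_padicLogForm_logB_primes h)

/-- **The barrier declaration `BakerMethodBounds` (= `BakerShapeBound (1/3) 3`) from the `log B`
form of Yu 2007 over `ℚ`**, through the primes-only texts and the route's proved Kummer door.
[cite: StewartYu2001, Theorem 1] -/
theorem bakerMethodBounds_of_yu2007_logB (h : yu2007_padicLogForm_logB_rat) :
    Literature.Barriers.ABC.BakerMethodBounds :=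
  padicPrimesKummerThird_kummerDoor_proof (y07Odd_of_yu2007_logB h) (y07Two_of_yu2007_logB h)

/-- **Stewart–Yu 2001, Theorem 1 (abc.S06, `stewart_yu`) from the `log B` form of Yu 2007 over `ℚ`**
— by the route's proved assembly; a trust path through rational primes only, independent of the
δ-form fact `Literature.Barriers.ABC.yu2007_padicLogForm_rat`. [cite: StewartYu2001, Theorem 1] -/
theorem stewart_yu_of_yu2007_logB (h : yu2007_padicLogForm_logB_rat) :
    Literature.NumberTheory.DiophantineGeometry.stewart_yu :=
  padicPrimesKummerThird_assembly_proof (y07Odd_of_yu2007_logB h) (y07Two_of_yu2007_logB h)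
    padicPrimesKummerThird_kummerDoor_proof

end Y07LogB

end Summit.ABC.StewartYu
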